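import Summits.Ventures.PercRepro.CodeAssembly
import Summits.Ventures.PercRepro.CodeRank
import Summits.Ventures.PercRepro.CodeQuadrant

/-!
# The 8-point code bound is a theorem: Lemma B for single-merge maps on ≤ 8 coordinates

`CodeBound8Fin` is assembled in `CodeAssembly.lean` from two inputs, the rank estimate `hH`
(`CodeRank.lean`, `hrank_le_finrank_span_signVec`) and the Kleitman estimate `hK`
(`CodeQuadrant.lean`, `card_typeRep_le_six`). Both are in hand, so `CodeBound8Fin`, its transport
`CodeBound8` and Lemma B for single-merge maps on at most eight coordinates are unconditional
theorems. (The correlation inequality C-005 for marked multigraphs with at most eight edges,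
`C005_of_card_le_eight'`, lives in `C005Eight.lean`: it also needs the face decomposition of
`LineC.lean`, and this file is kept free of that import so that Lemma B on ≤ 8 coordinates can
land independently.)
-/

namespace PercRepro

/-- **The 8-point code bound on `Fin 8`**: a complement-closed family of 4-subsets of `Fin 8`,
three-coloured so that complements change colour, differently coloured members meet in at most two
points and every ordered pair of colours occurs, has at most nine members. -/
theorem codeBound8Fin_holds : CodeBound8Fin :=
  codeBound8Fin_of_rank_of_kleitman hrank_le_finrank_span_signVec card_typeRep_le_six

/-- **The 8-point code bound** on an arbitrary 8-element coordinate type. -/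
theorem codeBound8_holds : CodeBound8 :=
  codeBound8_of_fin codeBound8Fin_holds

section Eight

variable {S : Type} [Fintype S] [DecidableEq S]

/-- **Lemma B for single-merge maps on at most eight coordinates**, unconditionally. -/
theorem crossCount_le_topBotCount_of_card_le_eight' (c : Config S → Setoid (Fin 4))
    (hc : Monotone c) (hsm : SingleMergeMap c) (h8 : Fintype.card S ≤ 8) :
    crossCount cross4 c ≤ topBotCount c :=
  crossCount_le_topBotCount_of_card_le_eight codeBound8_holds c hc hsm h8

end Eight

end PercRepro
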